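import Literature.NumberTheory.EllipticCurves.CongruentNumberCurveAdditiveReduction
import Literature.NumberTheory.DiophantineGeometry.LocalReductionHasMultiplicativeReductionAtProofs
import HarnessLib

/-!
# Local Euler factors read off an integral model, and `L`-functions place by place

Sibling file of `Literature.NumberTheory.DiophantineGeometry.LocalReduction` /
`Literature.NumberTheory.EllipticCurves.LFunctionPrimeCoeff` (D-0014 append protocol; everything
here is proved, no definitions). Mathlib's `L(E/K, s)` (`WeierstrassCurve.LFunction`, T. Browning
2026) is the Euler product over the finite places `v` of `K` of the local factors
`L_v(T)⁻¹ = (localPolynomial)⁻¹` computed on a *chosen* minimal model at `v` (Silverman, *AEC*,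
§C.16: `L_v(T) = 1 - a_vT + q_vT²`, `1 - T`, `1 + T`, `1`). To *compare* the `L`-functions of two
given curves one therefore needs `localPolynomial` in terms of a given equation. This file provides:

* `WeierstrassCurve.LFunction_eq_of_forall_localPolynomial_eq`: two curves over a number field
  whose local polynomials agree at every finite place have the same `L`-function (and conversely
  the local polynomial determines the local factor) — the form in which Knapp's Theorem 11.67
  ("isogenous curves over `ℚ` have the same `L`-function") is an identity of Euler products,
  *prime by prime* (Knapp, *Elliptic Curves*, proof of Thm. 11.67, PDF p. 281: "it is enough to
  prove equality of the `p`-th Euler factors").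
* `WeierstrassCurve.localPolynomial_eq_one_of_hasAdditiveReductionAt`: at a place of additive
  reduction `L_v(T) = 1` (Silverman §C.16).
* `WeierstrassCurve.localPolynomial_map_of_not_dvd`: for an integral model `E / ℤ` and a prime
  `p ∤ Δ_E` *of this model*, the local polynomial of `E_ℚ` at the place over `p` is
  `1 - a_pT + pT²` with `a_p = p + 1 - #E(𝔽_p)` counted on the reduction of `E` itself
  (Silverman VII.1 Rem. 1.1, VII.5.1(a), VII.1.3(b): the model is minimal at `p` with good
  reduction, and any two minimal models have isomorphic reductions; the plumbing is that of the
  tree's `Literature.NumberTheory.Automorphic.lFunction_map_apply_prime_of_not_dvd`).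
* `WeierstrassCurve.hasAdditiveReductionAt_of_valuation_Δ_of_cube_le`: **additive reduction read
  off any integral equation with integral `j`**: if the `aᵢ` are `v`-integral, `ord_v(Δ) = n` with
  `12 ∤ n`, and `3 ord_v(c₄) ≥ ord_v(Δ)` (i.e. `ord_v(j) ≥ 0`, or `c₄ = 0`), then `W` has additive
  reduction at `v`. Proof (Silverman VII.1 and VII.5.1): the chosen minimal model is `⟨u,r,s,t⟩ • W`
  with `Δ' = u⁻¹²Δ`, `c₄' = u⁻⁴c₄`; good reduction `ord(Δ') = 0` would force `12 ∣ n`, and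
  multiplicative reduction `ord(c₄') = 0 < ord(Δ')` would force `3 ord(c₄) < ord(Δ)`. Unlike
  Remark VII.1.1 (`ord_v(Δ) < 12`, the tree's `hasAdditiveReductionAt_of_valuation`) this needs no
  minimality of the given equation, which is what makes the additive places of the CM curves and
  of all their quadratic twists (`ord₂(Δ) = 14, 15, 18, …`) uniformly accessible.
* small valuation helpers over `ℚ` (`Rat.valuation_intCast_mul_pow`: `ord_p(p^e m) = e` for
  `p ∤ m`).

## References

* J. H. Silverman, *The Arithmetic of Elliptic Curves*, 2nd ed. (2009): VII.1 (Remark 1.1,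
  Prop. 1.3), VII.5 Prop. 5.1, §C.16 (definition of `L_v(T)`, PDF p. 390), Exercise 8.19.
  [cite: SilvermanAEC2009]
* A. W. Knapp, *Elliptic Curves*, Math. Notes 40 (1992), Thm. 11.67 and (10.9)–(10.10)
  (PDF pp. 222, 281–282). [cite: Knapp1993]
-/

noncomputable section

open scoped Classical

open IsDedekindDomain Polynomial

namespace WeierstrassCurve

/-! ## `L`-functions agree when all local polynomials agree -/

section NumberField

open NumberField

variable {K : Type*} [Field K] [NumberField K] {W W' : WeierstrassCurve K}

/-- **Two curves with the same local polynomial at every finite place have the same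
`L`-function** (Mathlib's `LFunction` is the Euler product of
`ofPowerSeries q_v (L_v(T)⁻¹)`). This is the prime-by-prime form of Knapp's Theorem 11.67.
[cite: Knapp1993, proof of Thm. 11.67 (PDF p. 281)] -/
theorem LFunction_eq_of_forall_localPolynomial_eq
    (h : ∀ v : HeightOneSpectrum (𝓞 K),
      (W.baseChange (v.adicCompletion K)).localPolynomial (v.adicCompletionIntegers K) =
        (W'.baseChange (v.adicCompletion K)).localPolynomial (v.adicCompletionIntegers K)) :
    W.LFunction = W'.LFunction := by
  unfold LFunction
  congr 1
  funext v
  rw [localEulerFactor, localEulerFactor, localPowerSeries, localPowerSeries, h v]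

/-- Hence also the same `L`-series, entire continuation data and analytic rank (all defined from
`LFunction`). [folklore] -/
theorem LSeries_eq_of_forall_localPolynomial_eq
    (h : ∀ v : HeightOneSpectrum (𝓞 K),
      (W.baseChange (v.adicCompletion K)).localPolynomial (v.adicCompletionIntegers K) =
        (W'.baseChange (v.adicCompletion K)).localPolynomial (v.adicCompletionIntegers K)) :
    W.LSeries = W'.LSeries := by
  funext s
  simp only [WeierstrassCurve.LSeries, LFunction_eq_of_forall_localPolynomial_eq h]

end NumberField

/-! ## The local polynomial at an additive place -/

section Additive

variable {A : Type*} [CommRing A] [IsDedekindDomain A] {K : Type*} [Field K]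
  [Algebra A K] [IsFractionRing A K] (v : HeightOneSpectrum A) (W : WeierstrassCurve K)

/-- **At a place of additive reduction the local polynomial is `1`** (Silverman, *AEC* §C.16:
`L_v(T) = 1` if `E` has additive reduction at `v`; for Mathlib's `localPolynomial`, computed on
the chosen minimal model, which is neither good nor (split) multiplicative). The tree's
`Literature.NumberTheory.EllipticCurves.localEulerFactor_eq_one_of_hasAdditiveReductionAt` is the same statement one level up.
[cite: SilvermanAEC2009, §C.16 (definition of L_v(T)), PDF p. 390] -/
theorem localPolynomial_eq_one_of_hasAdditiveReductionAt (h : W.HasAdditiveReductionAt v) :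
    (W.baseChange (v.adicCompletion K)).localPolynomial (v.adicCompletionIntegers K) = 1 := by
  have h' : ((W.baseChange (v.adicCompletion K)).minimal
      (v.adicCompletionIntegers K)).HasAdditiveReduction (v.adicCompletionIntegers K) := h
  unfold localPolynomial
  rw [if_neg h'.not_hasGoodReduction, if_neg, if_neg h'.not_hasMultiplicativeReduction]
  exact fun hs ↦ h'.not_hasMultiplicativeReduction _ hs.toHasMultiplicativeReduction

end Additive

/-! ## Additive reduction from `ord(Δ) ∉ 12ℤ` and `ord(j) ≥ 0` -/

section AdditiveCriterion

variable {A : Type*} [CommRing A] [IsDedekindDomain A] {K : Type*} [Field K]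
  [Algebra A K] [IsFractionRing A K] (v : HeightOneSpectrum A) (W : WeierstrassCurve K)

/-- **Additive reduction read off an integral equation with `12 ∤ ord_v(Δ)` and
`3 ord_v(c₄) ≥ ord_v(Δ)`.** Let the coefficients of `W / K` be `v`-integral, `ord_v(Δ) = n`
with `12 ∤ n` (so `n > 0`), and `|c₄|_v³ ≤ |Δ|_v` (integrality of `j = c₄³/Δ` at `v`; automatic
if `c₄ = 0`). Then `W` has additive reduction at `v`. Proof: the chosen minimal model at `v` is
`M = C • W_{K_v}` with `Δ_M = u⁻¹²Δ`, `c₄(M) = u⁻⁴c₄` (Silverman VII.1, Table 3.1); by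
VII.5 Prop. 5.1, `M` has good, multiplicative or additive reduction; good reduction
`|Δ_M| = 1` gives `|Δ| = |u|¹²`, i.e. `12 ∣ n`; multiplicative reduction `|c₄(M)| = 1`,
`|Δ_M| < 1` gives `|Δ| < |c₄|³`. (The valuation of `K_v` used by Mathlib's predicates is
equivalent to `v`, `isEquiv_valuation_maximalIdeal_valued`, which suffices to transport the two
(in)equalities back to `K`.)
[cite: SilvermanAEC2009, VII.5 Prop. 5.1 and VII.1 (Δ' = u⁻¹²Δ, c₄' = u⁻⁴c₄)] -/
theorem hasAdditiveReductionAt_of_valuation_Δ_of_cube_le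
    (h₁ : v.valuation K W.a₁ ≤ 1) (h₂ : v.valuation K W.a₂ ≤ 1) (h₃ : v.valuation K W.a₃ ≤ 1)
    (h₄ : v.valuation K W.a₄ ≤ 1) (h₆ : v.valuation K W.a₆ ≤ 1)
    {n : ℕ} (hΔ : v.valuation K W.Δ = WithZero.exp (-(n : ℤ))) (hn : ¬ 12 ∣ n)
    (hc₄ : v.valuation K W.c₄ ^ 3 ≤ v.valuation K W.Δ) : W.HasAdditiveReductionAt v := by
  have hint : W.IsIntegralAt v := W.isIntegralAt_of_valuation_le_one v h₁ h₂ h₃ h₄ h₆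
  set R := v.adicCompletionIntegers K with hR
  set L := v.adicCompletion K with hL
  set X : WeierstrassCurve L := W.baseChange L with hX
  haveI hXint : X.IsIntegral R := hint
  obtain ⟨C, hC⟩ : ∃ C : VariableChange L, W.localMinimalModel v = C • X := ⟨_, rfl⟩
  haveI hmin : (C • X).IsMinimal R := hC ▸ inferInstance
  have hequiv := isEquiv_valuation_maximalIdeal_valued (K := K) v
  -- the two invariants, read in `K_v` through `Valued.v`
  set V : Valuation L (WithZero (Multiplicative ℤ)) := Valued.v with hV
  have hΔX : X.Δ = algebraMap K L W.Δ := by rw [hX, WeierstrassCurve.baseChange, map_Δ]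
  have hc₄X : X.c₄ = algebraMap K L W.c₄ := by rw [hX, WeierstrassCurve.baseChange, map_c₄]
  have hVΔ : V X.Δ = WithZero.exp (-(n : ℤ)) := by
    rw [hΔX, hV, valued_algebraMap_adicCompletion, hΔ]
  have hVc₄ : V X.c₄ ^ 3 ≤ V X.Δ := by
    rw [hΔX, hc₄X, hV, valued_algebraMap_adicCompletion, valued_algebraMap_adicCompletion]
    exact hc₄
  have hV0 : V ((C.u⁻¹ : Lˣ) : L) ≠ 0 := (Valuation.ne_zero_iff _).mpr (Units.ne_zero _)
  rcases hasGoodReduction_or_hasMultiplicativeReduction_or_hasAdditiveReduction R (W := C • X)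
    with hg | hm | ha
  · -- good reduction is impossible: `|Δ| = |u|¹²` but `12 ∤ n`
    exfalso
    have h1 : V ((C • X).Δ) = 1 := hequiv.eq_one_iff_eq_one.mp hg.goodReduction
    rw [variableChange_Δ, map_mul, map_pow, hVΔ, ← WithZero.exp_log hV0, ← WithZero.exp_nsmul,
      ← WithZero.exp_add, WithZero.exp_eq_one] at h1
    apply hn
    have h3 : (12 : ℤ) ∣ (n : ℤ) := ⟨WithZero.log (V ((C.u⁻¹ : Lˣ) : L)), by
      simp only [nsmul_eq_mul, Nat.cast_ofNat] at h1; linarith⟩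
    exact_mod_cast h3
  · -- multiplicative reduction is impossible: `|c₄'| = 1`, `|Δ'| < 1` give `|Δ| < |c₄|³`
    exfalso
    have h1 : V ((C • X).c₄) = 1 := hequiv.eq_one_iff_eq_one.mp hm.multiplicativeReduction
    have h2 : V ((C • X).Δ) < 1 := hequiv.lt_one_iff_lt_one.mp hm.badReduction
    rw [variableChange_c₄, map_mul, map_pow] at h1
    rw [variableChange_Δ, map_mul, map_pow] at h2
    have h3 : V ((C.u⁻¹ : Lˣ) : L) ^ 12 * V X.c₄ ^ 3 = 1 := by
      rw [show V ((C.u⁻¹ : Lˣ) : L) ^ 12 * V X.c₄ ^ 3 =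
        (V ((C.u⁻¹ : Lˣ) : L) ^ 4 * V X.c₄) ^ 3 by rw [mul_pow, ← pow_mul], h1, one_pow]
    have h4 : V ((C.u⁻¹ : Lˣ) : L) ^ 12 * V X.c₄ ^ 3 ≤ V ((C.u⁻¹ : Lˣ) : L) ^ 12 * V X.Δ :=
      mul_le_mul' le_rfl hVc₄
    rw [h3] at h4
    exact absurd h2 (not_lt.mpr h4)
  · show (W.localMinimalModel v).HasAdditiveReduction R
    rw [hC]
    exact ha

end AdditiveCriterion

/-! ## Valuations of integers at a finite place of `ℚ` -/

section RatValuation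

open NumberField Rat.HeightOneSpectrum

variable (v : HeightOneSpectrum (𝓞 ℚ))

/-- `|p_v ^ e · m|_v = exp(-e)` for `p_v ∤ m`. [folklore] -/
theorem Rat.valuation_pow_mul_intCast {m : ℤ} (h : ¬ ((natGenerator v : ℕ) : ℤ) ∣ m) (e : ℕ) :
    v.valuation ℚ ((natGenerator v : ℚ) ^ e * m) = WithZero.exp (-(e : ℤ)) := by
  rw [Valuation.map_mul, Valuation.map_pow, Literature.NumberTheory.GaloisRepresentations.Rat.valuation_natGenerator,
    Literature.NumberTheory.GaloisRepresentations.Rat.valuation_intCast_eq_one v h, mul_one, ← WithZero.exp_nsmul]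
  simp

/-- An integer has valuation `≤ 1`. [folklore] -/
theorem Rat.valuation_intCast_le_one (n : ℤ) : v.valuation ℚ (n : ℚ) ≤ 1 := by
  rw [← map_intCast (algebraMap (𝓞 ℚ) ℚ) n]
  exact v.valuation_le_one _

/-- The coefficients of a `ℤ`-model are `v`-integral. [folklore] -/
theorem valuation_map_a_le_one (E : WeierstrassCurve ℤ) :
    v.valuation ℚ (E.map (Int.castRingHom ℚ)).a₁ ≤ 1 ∧
      v.valuation ℚ (E.map (Int.castRingHom ℚ)).a₂ ≤ 1 ∧
        v.valuation ℚ (E.map (Int.castRingHom ℚ)).a₃ ≤ 1 ∧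
          v.valuation ℚ (E.map (Int.castRingHom ℚ)).a₄ ≤ 1 ∧
            v.valuation ℚ (E.map (Int.castRingHom ℚ)).a₆ ≤ 1 := by
  refine ⟨?_, ?_, ?_, ?_, ?_⟩ <;>
    simp only [map_a₁, map_a₂, map_a₃, map_a₄, map_a₆, eq_intCast] <;>
    exact Rat.valuation_intCast_le_one v _

/-- **Additive reduction of a `ℤ`-model from `ord_p(Δ) = n ∉ 12ℤ` and `p^n ∣ c₄³`-type data.**
`ℤ`-model form of `hasAdditiveReductionAt_of_valuation_Δ_of_cube_le`: if `Δ_E = p^n · m` with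
`p ∤ m`, `12 ∤ n`, and `|c₄|_p³ ≤ |Δ|_p`, then `E_ℚ` has additive reduction at the place over
`p`. [cite: SilvermanAEC2009, VII.5 Prop. 5.1 and VII.1] -/
theorem hasAdditiveReductionAt_map_of_Δ_eq (E : WeierstrassCurve ℤ) {n : ℕ} {m : ℤ}
    (hΔ : E.Δ = (natGenerator v : ℤ) ^ n * m) (hm : ¬ ((natGenerator v : ℕ) : ℤ) ∣ m)
    (hn : ¬ 12 ∣ n)
    (hc₄ : v.valuation ℚ ((E.c₄ : ℤ) : ℚ) ^ 3 ≤ v.valuation ℚ ((E.Δ : ℤ) : ℚ)) :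
    (E.map (Int.castRingHom ℚ)).HasAdditiveReductionAt v := by
  obtain ⟨h₁, h₂, h₃, h₄, h₆⟩ := valuation_map_a_le_one v E
  refine hasAdditiveReductionAt_of_valuation_Δ_of_cube_le v _ h₁ h₂ h₃ h₄ h₆ (n := n) ?_ hn ?_
  · rw [map_Δ, eq_intCast, hΔ]
    push_cast
    exact Rat.valuation_pow_mul_intCast v hm n
  · rwa [map_Δ, map_c₄, eq_intCast, eq_intCast]

end RatValuation

/-! ## The local polynomial of a `ℤ`-model at a prime `p ∤ Δ` -/

section GoodModel

open NumberField Rat.HeightOneSpectrum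

variable (v : HeightOneSpectrum (𝓞 ℚ))

/-- **`L_p(T) = 1 - a_pT + pT²` with `a_p = p + 1 - #E(𝔽_p)` for any integral model with
`p ∤ Δ_E`.** Let `E : WeierstrassCurve ℤ` and let `v` be the place of `ℚ` over a prime `p` not
dividing the discriminant `Δ_E` *of this model*. Then Mathlib's local polynomial of `E_ℚ` at `v`
(computed on the chosen minimal model of `E ⊗ ℚ_v`) is `1 - a_pT + pT²` where `#E(𝔽_p)` counts
the points of the reduction of `E` itself modulo `p`. Proof: `E` is `p`-integral with `p`-unit
discriminant, hence minimal at `p` with good reduction (Silverman VII.1 Rem. 1.1, VII.5.1(a));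
the chosen minimal model is another minimal equation, so the two reductions are isomorphic over
`κ(v) ≃ ℤ/p` (VII.1.3(b); the tree's `natCard_point_reduction_minimal`). Same plumbing as
`Literature.NumberTheory.Automorphic.lFunction_map_apply_prime_of_not_dvd`, one level down (local polynomial rather than
`p`-th coefficient). [cite: SilvermanAEC2009, VII.1 Rem. 1.1, Prop. VII.1.3(b), VII.5.1(a), §C.16] -/
theorem localPolynomial_map_of_not_dvd (E : WeierstrassCurve ℤ)
    (hpΔ : ¬ ((natGenerator v : ℕ) : ℤ) ∣ E.Δ) :
    ((E.map (Int.castRingHom ℚ)).baseChange (v.adicCompletion ℚ)).localPolynomial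
        (v.adicCompletionIntegers ℚ) =
      1 - Polynomial.C ((natGenerator v : ℤ) + 1 -
          (Nat.card (E.map (Int.castRingHom (ZMod (natGenerator v)))).toAffine.Point : ℤ)) * X +
        Polynomial.C (natGenerator v : ℤ) * X ^ 2 := by
  haveI := Fact.mk (primesEquiv v).2
  set W : WeierstrassCurve ℚ := E.map (Int.castRingHom ℚ) with hW
  have hΔ1 : v.valuation ℚ W.Δ = 1 := by
    rw [hW, map_Δ, eq_intCast]
    exact Literature.NumberTheory.GaloisRepresentations.Rat.valuation_intCast_eq_one v hpΔ
  obtain ⟨h₁, h₂, h₃, h₄, h₆⟩ := valuation_map_a_le_one v E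
  haveI hint : W.IsIntegralAt v := W.isIntegralAt_of_valuation_le_one v h₁ h₂ h₃ h₄ h₆
  have hΔv : (IsDiscreteValuationRing.maximalIdeal (v.adicCompletionIntegers ℚ)).valuation
      (v.adicCompletion ℚ) (W.baseChange (v.adicCompletion ℚ)).Δ = 1 := by
    rw [WeierstrassCurve.baseChange, map_Δ]
    exact valuation_maximalIdeal_adicCompletion_eq_one hΔ1
  haveI hmin : W.IsMinimalAt v := isMinimal_of_valuation_Δ_eq_one _ hΔv
  have hgood : W.HasGoodReductionAt v :=
    W.hasGoodReductionAt_of_valuation_le_one_of_valuation_Δ_eq_one v h₁ h₂ h₃ h₄ h₆ hΔ1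
  have hΔ0 : (W.baseChange (v.adicCompletion ℚ)).Δ ≠ 0 := by
    rw [WeierstrassCurve.baseChange, map_Δ, _root_.map_ne_zero, hW, map_Δ, eq_intCast, Int.cast_ne_zero]
    rintro h0
    exact hpΔ (h0 ▸ dvd_zero _)
  have hmodel : integralModel (v.adicCompletionIntegers ℚ) (W.baseChange (v.adicCompletion ℚ)) =
      E.map (Int.castRingHom (v.adicCompletionIntegers ℚ)) := by
    refine integralModel_eq_of_baseChange_eq _ _ ?_
    rw [WeierstrassCurve.baseChange, WeierstrassCurve.baseChange, hW, map_map, map_map]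
    exact congrArg E.map (RingHom.ext_int _ _)
  have hg : ((W.baseChange (v.adicCompletion ℚ)).minimal
      (v.adicCompletionIntegers ℚ)).HasGoodReduction (v.adicCompletionIntegers ℚ) := hgood
  have hcount : Nat.card (((W.baseChange (v.adicCompletion ℚ)).minimal
      (v.adicCompletionIntegers ℚ)).reduction (v.adicCompletionIntegers ℚ)).toAffine.Point =
      Nat.card (E.map (Int.castRingHom (ZMod (primesEquiv v : ℕ)))).toAffine.Point := by
    rw [natCard_point_reduction_minimal _ hΔ0, reduction, hmodel, map_map,
      ← natCard_point_map_ringEquiv ((IsLocalRing.ResidueField.mapEquiv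
        (adicCompletionIntegers.padicIntEquiv v).toAlgEquiv.toRingEquiv).trans
        (PadicInt.residueField (p := (primesEquiv v : ℕ)))) (E.map _), map_map]
    exact congrArg (fun g : ℤ →+* ZMod (primesEquiv v : ℕ) ↦
      Nat.card (E.map g).toAffine.Point) (RingHom.ext_int _ _)
  unfold localPolynomial
  rw [if_pos hg, natCard_residueField_adicCompletionIntegers, hcount]
  rfl

/-- **Local polynomials of two `ℤ`-models agree at a common good prime when the reductions have
equally many points** (the good-prime step of Knapp's Thm. 11.67: "isogenous curves over `𝔽_p`
have the same number of points, hence the same `p`-th factor").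
[cite: Knapp1993, proof of Thm. 11.67 (PDF pp. 281–282)] -/
theorem localPolynomial_map_eq_of_natCard_eq (E E' : WeierstrassCurve ℤ)
    (hpΔ : ¬ ((natGenerator v : ℕ) : ℤ) ∣ E.Δ) (hpΔ' : ¬ ((natGenerator v : ℕ) : ℤ) ∣ E'.Δ)
    (hN : Nat.card (E.map (Int.castRingHom (ZMod (natGenerator v)))).toAffine.Point =
      Nat.card (E'.map (Int.castRingHom (ZMod (natGenerator v)))).toAffine.Point) :
    ((E.map (Int.castRingHom ℚ)).baseChange (v.adicCompletion ℚ)).localPolynomial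
        (v.adicCompletionIntegers ℚ) =
      ((E'.map (Int.castRingHom ℚ)).baseChange (v.adicCompletion ℚ)).localPolynomial
        (v.adicCompletionIntegers ℚ) := by
  rw [localPolynomial_map_of_not_dvd v E hpΔ, localPolynomial_map_of_not_dvd v E' hpΔ', hN]

/-- **Local polynomials of two curves agree at a common additive place** (both are `1`).
[cite: SilvermanAEC2009, §C.16] -/
theorem localPolynomial_eq_of_hasAdditiveReductionAt {W W' : WeierstrassCurve ℚ}
    (h : W.HasAdditiveReductionAt v) (h' : W'.HasAdditiveReductionAt v) :
    (W.baseChange (v.adicCompletion ℚ)).localPolynomial (v.adicCompletionIntegers ℚ) =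
      (W'.baseChange (v.adicCompletion ℚ)).localPolynomial (v.adicCompletionIntegers ℚ) := by
  rw [localPolynomial_eq_one_of_hasAdditiveReductionAt v W h,
    localPolynomial_eq_one_of_hasAdditiveReductionAt v W' h']

end GoodModel

end WeierstrassCurve
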